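import Mathlib
import HarnessLib
import Summits.HubbardSuperconductivity.HubbardSuperconductivity.Theorems.KLProgrammeKLRegimeEngineValueClausesV17FAssembly

/-!
# K3 ENGINE-FLOW child (stmt-HubbardSuperconductivity-20368 `KLRegimeEngineV17F`), stub (c) F shape: how the CROSS-FRAME value increment splits into the
# SAME-FRAME increment (the within-slice flow's output at `K_n`) and the FRAME SHIFT of the scale-`(n−1)` amplitude (`frameShiftBar`, p2's S6 door (1))
# — S6 «k3c2-p2 token re-key», part 1c (cell gate-hubbard-kl, seat hubbard-kl-k3c2-p2 g7)

`𝒞_n[K_n] − 𝒞_{n−1}[K_{n−1}] = (𝒞_n[K_n] − 𝒞_{n−1}[K_n]) + (𝒞_{n−1}[K_n] − 𝒞_{n−1}[K_{n−1}])`: the first bracket is what the one-shot single-scale machinery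
at the FIXED frame `K_n` delivers (k3c1-p1's `klws_increment_of_scaleFlow` / the ph-loop rows of PH-LOOP-SIGNBLIND-INDEX, all keyed on a free `K`), the
second is the frame response of the scale-`(n−1)` amplitude, booked by `frameShiftBar P Q U n` (…SplitSlotsV17F §1).  This file states the split BY NAME:

* `klvrF_crossFrame_norm_le` (triangle inequality in the slot's currency);
* **`klvrF_outClass_of_sameFrame_frameShift`** — the OUT-OF-CLASS half of (E2″-F) from a same-frame bound `≤ gainBar + eremBar + thermalBar + legDressBarQ2`
  at `K_n` and a frame-shift bound `≤ frameShiftBar`; `klvrF_inClass_of_sameFrame_frameShift` (same shape in class, for takers who prove the in-class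
  half at the fixed frame too); **`klvrF_pairValueIncrementAtV17F_of_sameFrame_frameShift`** (all `Qm`);
* `klvrF_outClass_of_frameShift_sameFrame` (g19, «UNSMEAR-RESUMMED»): the other order — frame shift of the scale-`n` amplitude first, then the same-frame
  increment at the LOWER frame `K_{n−1}` (class #5's frame for the un-smearing part).

Bookkeeping only; nothing about the model is asserted; nothing asserts superconductivity.
-/

noncomputable section

namespace Summit.HubbardSuperconductivity.HubbardSuperconductivity.Theorems.KLRegimeSplit

set_option linter.dupNamespace false -- summit = problem name (single-conjunct summit), D-0017

open Real Finset Literature.MathematicalPhysics.QuantumLattice Literature.Probability.LatticeModels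
open Summit.HubbardSuperconductivity.HubbardSuperconductivity.Theorems.KLProgrammeLegKernels

section Model

variable {L M : ℕ} [NeZero L] [NeZero M] {G : GeoConsts} {P : SplitConsts} {Q : EngConsts} {β U μ : ℝ} {n : ℕ}

/-- **Cross-frame = same-frame + frame shift** (triangle inequality): for any frames `K, K′`, scales `n, m`, labels,
`‖𝒞_n[K] − 𝒞_m[K′]‖ ≤ ‖𝒞_n[K] − 𝒞_m[K]‖ + ‖𝒞_m[K] − 𝒞_m[K′]‖`. -/
theorem klvrF_crossFrame_norm_le (K K' : TrigPolyC4v) (n m : ℕ) (Qm k k' : TorusSite 2 L) :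
    ‖klPairAmplitude L M β U μ K n Qm k k' - klPairAmplitude L M β U μ K' m Qm k k'‖ ≤
      ‖klPairAmplitude L M β U μ K n Qm k k' - klPairAmplitude L M β U μ K m Qm k k'‖ +
        ‖klPairAmplitude L M β U μ K m Qm k k' - klPairAmplitude L M β U μ K' m Qm k k'‖ :=
  norm_sub_le_norm_sub_add_norm_sub _ _ _

/-- **The OUT-OF-CLASS half of (E2″-F) from the two doors**: a SAME-FRAME increment bound at `K_n` with the (E2″) budget
`gainBar + eremBar(n−1) + thermalBar n + legDressBarQ2` (count read at `K_n`) and a FRAME-SHIFT bound `≤ frameShiftBar P Q U n` for the scale-`(n−1)`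
amplitude between `K_n` and `K_{n−1}`, both on the bare ball and for `Qm` out of class, give the out-of-class hypothesis of `klvrF_stepValues_of_parts`. -/
theorem klvrF_outClass_of_sameFrame_frameShift
    (hsame : ∀ Qm : TorusSite 2 L, ¬ IsPairClassAt L Qm n → ∀ k ∈ klBall L μ 0, ∀ k' ∈ klBall L μ 0,
      ‖klPairAmplitude L M β U μ (klFlowFrameU L M β U μ n) n Qm k k' -
          klPairAmplitude L M β U μ (klFlowFrameU L M β U μ n) (n - 1) Qm k k'‖ ≤
        gainBar G P U n (klTorusNorm L Qm) (klTorusNorm L (k - k')) (klTorusNorm L (k + k' - Qm)) +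
          eremBar G P Q U β L (n - 1) + thermalBar G P U β n +
            legDressBarQ2 G P Q U n (legSliceCountT L β μ (klFlowFrameU L M β U μ n) n ![k', Qm - k', Qm - k, k]))
    (hshift : ∀ Qm : TorusSite 2 L, ¬ IsPairClassAt L Qm n → ∀ k ∈ klBall L μ 0, ∀ k' ∈ klBall L μ 0,
      ‖klPairAmplitude L M β U μ (klFlowFrameU L M β U μ n) (n - 1) Qm k k' -
          klPairAmplitude L M β U μ (klFlowFrameU L M β U μ (n - 1)) (n - 1) Qm k k'‖ ≤ frameShiftBar P Q U n) :
    ∀ Qm : TorusSite 2 L, ¬ IsPairClassAt L Qm n → ∀ k ∈ klBall L μ 0, ∀ k' ∈ klBall L μ 0,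
      ‖klPairAmplitude L M β U μ (klFlowFrameU L M β U μ n) n Qm k k' -
          klPairAmplitude L M β U μ (klFlowFrameU L M β U μ (n - 1)) (n - 1) Qm k k'‖ ≤
        gainBar G P U n (klTorusNorm L Qm) (klTorusNorm L (k - k')) (klTorusNorm L (k + k' - Qm)) +
          eremBar G P Q U β L (n - 1) + thermalBar G P U β n +
            legDressBarQ2 G P Q U n (legSliceCountT L β μ (klFlowFrameU L M β U μ n) n ![k', Qm - k', Qm - k, k]) +
              frameShiftBar P Q U n := by
  intro Qm hQm k hk k' hk'
  have h := klvrF_crossFrame_norm_le (M := M) (β := β) (U := U) (μ := μ) (klFlowFrameU L M β U μ n) (klFlowFrameU L M β U μ (n - 1)) n (n - 1) Qm k k'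
  linarith [hsame Qm hQm k hk k' hk', hshift Qm hQm k hk k' hk']

/-- The same split IN CLASS (for a taker who proves the in-class half at the fixed frame `K_n` as well). -/
theorem klvrF_inClass_of_sameFrame_frameShift
    (hsame : ∀ Qm : TorusSite 2 L, IsPairClassAt L Qm n → ∀ k ∈ klBall L μ 0, ∀ k' ∈ klBall L μ 0,
      ‖klPairAmplitude L M β U μ (klFlowFrameU L M β U μ n) n Qm k k' -
          klPairAmplitude L M β U μ (klFlowFrameU L M β U μ n) (n - 1) Qm k k'‖ ≤
        gainBar G P U n (klTorusNorm L Qm) (klTorusNorm L (k - k')) (klTorusNorm L (k + k' - Qm)) +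
          eremBar G P Q U β L (n - 1) + thermalBar G P U β n +
            legDressBarQ2 G P Q U n (legSliceCountT L β μ (klFlowFrameU L M β U μ n) n ![k', Qm - k', Qm - k, k]))
    (hshift : ∀ Qm : TorusSite 2 L, IsPairClassAt L Qm n → ∀ k ∈ klBall L μ 0, ∀ k' ∈ klBall L μ 0,
      ‖klPairAmplitude L M β U μ (klFlowFrameU L M β U μ n) (n - 1) Qm k k' -
          klPairAmplitude L M β U μ (klFlowFrameU L M β U μ (n - 1)) (n - 1) Qm k k'‖ ≤ frameShiftBar P Q U n) :
    ∀ Qm : TorusSite 2 L, IsPairClassAt L Qm n → ∀ k ∈ klBall L μ 0, ∀ k' ∈ klBall L μ 0,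
      ‖klPairAmplitude L M β U μ (klFlowFrameU L M β U μ n) n Qm k k' -
          klPairAmplitude L M β U μ (klFlowFrameU L M β U μ (n - 1)) (n - 1) Qm k k'‖ ≤
        gainBar G P U n (klTorusNorm L Qm) (klTorusNorm L (k - k')) (klTorusNorm L (k + k' - Qm)) +
          eremBar G P Q U β L (n - 1) + thermalBar G P U β n +
            legDressBarQ2 G P Q U n (legSliceCountT L β μ (klFlowFrameU L M β U μ n) n ![k', Qm - k', Qm - k, k]) +
              frameShiftBar P Q U n := by
  intro Qm hQm k hk k' hk'
  have h := klvrF_crossFrame_norm_le (M := M) (β := β) (U := U) (μ := μ) (klFlowFrameU L M β U μ n) (klFlowFrameU L M β U μ (n - 1)) n (n - 1) Qm k k'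
  linarith [hsame Qm hQm k hk k' hk', hshift Qm hQm k hk k' hk']

/-- **(E2″-F) from a same-frame (E2″)-budget bound at `K_n` (every `Qm`) and the frame-shift door.** -/
theorem klvrF_pairValueIncrementAtV17F_of_sameFrame_frameShift
    (hsame : ∀ Qm : TorusSite 2 L, ∀ k ∈ klBall L μ 0, ∀ k' ∈ klBall L μ 0,
      ‖klPairAmplitude L M β U μ (klFlowFrameU L M β U μ n) n Qm k k' -
          klPairAmplitude L M β U μ (klFlowFrameU L M β U μ n) (n - 1) Qm k k'‖ ≤
        gainBar G P U n (klTorusNorm L Qm) (klTorusNorm L (k - k')) (klTorusNorm L (k + k' - Qm)) +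
          eremBar G P Q U β L (n - 1) + thermalBar G P U β n +
            legDressBarQ2 G P Q U n (legSliceCountT L β μ (klFlowFrameU L M β U μ n) n ![k', Qm - k', Qm - k, k]))
    (hshift : ∀ Qm : TorusSite 2 L, ∀ k ∈ klBall L μ 0, ∀ k' ∈ klBall L μ 0,
      ‖klPairAmplitude L M β U μ (klFlowFrameU L M β U μ n) (n - 1) Qm k k' -
          klPairAmplitude L M β U μ (klFlowFrameU L M β U μ (n - 1)) (n - 1) Qm k k'‖ ≤ frameShiftBar P Q U n) :
    PairValueIncrementAtV17F L M G P Q β U μ n :=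
  klvrF_pairValueIncrementAtV17F_of_inClass_outClass
    (klvrF_inClass_of_sameFrame_frameShift (fun Qm _ => hsame Qm) (fun Qm _ => hshift Qm))
    (klvrF_outClass_of_sameFrame_frameShift (fun Qm _ => hsame Qm) (fun Qm _ => hshift Qm))

/-- **The OUT-OF-CLASS half of (E2″-F), the OTHER order of the two doors** («UNSMEAR-RESUMMED», cell STATUS (R240)/k3c2-p2 g19): FRAME SHIFT of the
scale-`n` amplitude FIRST (`‖𝒞_n[K_n] − 𝒞_n[K_{n−1}]‖ ≤ frameShiftBar P Q U n`), then the SAME-FRAME increment at the LOWER frame `K_{n−1}`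
(`‖𝒞_n[K_{n−1}] − 𝒞_{n−1}[K_{n−1}]‖ ≤ gainBar + eremBar(n−1) + thermalBar n + legDressBarQ2`, count read at `K_n`) — so that the un-smearing part of the
same-frame bracket is read at class #5's own frame `K_{n−1}`. -/
theorem klvrF_outClass_of_frameShift_sameFrame
    (hshift : ∀ Qm : TorusSite 2 L, ¬ IsPairClassAt L Qm n → ∀ k ∈ klBall L μ 0, ∀ k' ∈ klBall L μ 0,
      ‖klPairAmplitude L M β U μ (klFlowFrameU L M β U μ n) n Qm k k' -
          klPairAmplitude L M β U μ (klFlowFrameU L M β U μ (n - 1)) n Qm k k'‖ ≤ frameShiftBar P Q U n)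
    (hsame : ∀ Qm : TorusSite 2 L, ¬ IsPairClassAt L Qm n → ∀ k ∈ klBall L μ 0, ∀ k' ∈ klBall L μ 0,
      ‖klPairAmplitude L M β U μ (klFlowFrameU L M β U μ (n - 1)) n Qm k k' -
          klPairAmplitude L M β U μ (klFlowFrameU L M β U μ (n - 1)) (n - 1) Qm k k'‖ ≤
        gainBar G P U n (klTorusNorm L Qm) (klTorusNorm L (k - k')) (klTorusNorm L (k + k' - Qm)) +
          eremBar G P Q U β L (n - 1) + thermalBar G P U β n +
            legDressBarQ2 G P Q U n (legSliceCountT L β μ (klFlowFrameU L M β U μ n) n ![k', Qm - k', Qm - k, k])) :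
    ∀ Qm : TorusSite 2 L, ¬ IsPairClassAt L Qm n → ∀ k ∈ klBall L μ 0, ∀ k' ∈ klBall L μ 0,
      ‖klPairAmplitude L M β U μ (klFlowFrameU L M β U μ n) n Qm k k' -
          klPairAmplitude L M β U μ (klFlowFrameU L M β U μ (n - 1)) (n - 1) Qm k k'‖ ≤
        gainBar G P U n (klTorusNorm L Qm) (klTorusNorm L (k - k')) (klTorusNorm L (k + k' - Qm)) +
          eremBar G P Q U β L (n - 1) + thermalBar G P U β n +
            legDressBarQ2 G P Q U n (legSliceCountT L β μ (klFlowFrameU L M β U μ n) n ![k', Qm - k', Qm - k, k]) +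
              frameShiftBar P Q U n := by
  intro Qm hQm k hk k' hk'
  have h := norm_sub_le_norm_sub_add_norm_sub (klPairAmplitude L M β U μ (klFlowFrameU L M β U μ n) n Qm k k')
    (klPairAmplitude L M β U μ (klFlowFrameU L M β U μ (n - 1)) n Qm k k') (klPairAmplitude L M β U μ (klFlowFrameU L M β U μ (n - 1)) (n - 1) Qm k k')
  linarith [hsame Qm hQm k hk k' hk', hshift Qm hQm k hk k' hk']

end Model

end Summit.HubbardSuperconductivity.HubbardSuperconductivity.Theorems.KLRegimeSplit

end
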